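import Summits.HodgeConjecture.HodgeConjecture.Statement
import Summits.HodgeConjecture.HodgeConjecture.Theorems.Ring2HypothesesDescentAlgebraicCorrespondencesSemisimpleInstances
import Literature.AlgebraicGeometry.HodgeTheory.LefschetzStandardOfHodgeConjectureSquare
import Literature.AlgebraicGeometry.HodgeTheory.LefschetzStandardUnconditionalDegrees
import Literature.AlgebraicGeometry.HodgeTheory.HodgeClassesBlowupBirationalInvariance
import HarnessLib

/-!
# Grothendieck's Lefschetz standard conjecture `B(X)` OFF the abelian locus, as HC-SHADOW rows
# (cell `hodge-nonav`, sector §3.14 SCB; tier-2 sketch P1S made tree-shaped)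

PROVENANCE. Cell hodge-nonav (HUMAN RULING D-0038), planner seat p1 g20: memo `HOME/memos/ROUTE-P1S.md`, frozen sketch
`HOME/p1/route/Sketch_P1S_SCB_g20.lean` (sha16 24d9a190c28697e8, 229 lines, namespace `HodgeNonAV.P1S`, farm rc 0 / 0 sorries /
axioms {propext, Classical.choice, Quot.sound}; re-elaborated 2026-08-28), landed by the prover seat `hodge-nonav-20241-p1` (g10) on the
planner's assignment (p1 g35, STATUS 2026-08-28T04:21:42Z) with `--supports stmt-HodgeConjecture-19654 --as helper` (SectorComplement
residual: `B(X)` for every `X` is a NECESSARY CONDITION of the summit). Cell namespace renamed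
`Summit.HodgeConjecture.HodgeConjecture.Theorems.LefschetzStandardShadows`; proof bodies verbatim.

WHAT IS HERE. The sector TYPES the rungs of "`B(X)` beyond abelian varieties" over the tree's carriers —
`StandardConjectureBStar n X η` (André's `⋆_L`-form of `B(X)`, file `Literature/…/MotivatedClasses`), `HodgeConjectureFor`,
`IsSmoothBlowupAlong` — and certifies, sorry-free, the implications the tree already decides:

* §1 OPEN rungs as parameterless `def … : Prop` (nothing asserted): `LefschetzStandardAll` (SCB-∞, Grothendieck 1968),
  `LefschetzStandardThreefolds` (SCB-3), `LefschetzStandardFourfolds` (SCB-4), `HodgeCodimTwoSquaresOfThreefolds` (HC22sq3: rational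
  `(2,2)`-classes on squares of threefolds), and the blow-up rung `StandardBAscendsSmoothBlowups` (SCB-BL: `B⋆(X) ∧ B⋆(Z) ⇒ B⋆(Bl_Z X)`,
  the `B`-analogue of the tree's `Arapura2001_hodgeClasses_algebraic_smoothBlowup_holds`).
* §2 SHADOW certificates: the summit `HodgeConjecture` implies `B(X)` for every `X` (`lefschetzStandardAll_of_hodgeConjecture`, via the
  tree's `standardConjectureBStar_of_hodgeConjectureFor_prod` = `HC(X × X) ⇒ B(X)`) and implies HC22sq3; HC22sq3 alone gives `B` for all
  threefolds (`lefschetzStandardThreefolds_of_codimTwo`, via the tree's `standardConjectureBStar_threefold_of_codimTwo`). So every OPEN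
  `B`-row is a necessary condition of the summit: a disproof of any of them refutes `HodgeConjecture` (kill-value), a proof is a rung on
  André's motivated road (`B(X) ∀ X` ⇒ motivated = algebraic).
* §3 fact-free corollaries of SCB-BL: `B⋆` is stable under blowing up smooth centres of dimension `≤ 2` in any dimension (the centre's
  `B` is the tree theorem `forall_standardConjectureBStar_of_dim_le_two`), in particular under every smooth blow-up of a threefold and
  along finite towers of such.

NOT RE-LANDED (alias-only rows of the sketch; the tree theorems ARE the rows): SCB-≤2 = `forall_standardConjectureBStar_of_dim_le_two`;
SCB-3⁰ = `standardConjectureBStar_threefold_of_forall_isOfHodgeType_one_one`; SCB-4⁰ = `standardConjectureBStar_fourfold_of_forall_isOfHodgeType_one_one`;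
SCB-surj = `standardConjectureBStar_of_surjective_of_forall`; SCB-× = `Ring2.AbelianAll.standardConjectureBStar_tensor_of_forall`;
SCB-dom≤2 ∕ SCB-dom = `standardConjectureBStar_of_isDominatedByPowers_of_dim_le_two` ∕ `…_of_forall`; SCB-Hilb =
`standardConjectureBStar_hilbertScheme_of_decataldoMigliorini`; FACT rows SCB-K3ⁿ ∕ SCB-T11 = the named facts
`CharlesMarkman2013_lefschetzStandard_K3HilbertType` ∕ `Tankeev2011_lefschetzStandard_abelianSurfacePencilThreefold` applied verbatim.

HONEST SCOPE. Nothing here proves `B(X)` for a new `X`, let alone the Hodge conjecture; the five `def`s are OPEN statements (SCB-BL is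
expected to be assemblable over the tree: `H*(Bl_Z X)` is spanned by `b^* H*(X)` and `j_* (q^* H*(Z) ∪ ζⁱ)`, all algebraic correspondences
from `X ⊗ Z`, whence domination by powers of `X ⊗ Z` and `standardConjectureBStar_of_isDominatedByPowers_of_forall` — recorded as a rung,
not claimed). Rung F-H1 is not moved. Printed loci quoted in the docstrings (Tankeev, Hu–Li, Arapura, Charles–Markman, Foster) are
attributions of where `B` is KNOWN, cited in prose only.

References (prose): A. Grothendieck, Standard conjectures on algebraic cycles (1969) §3; S. Kleiman, Algebraic cycles and the Weil
conjectures (1968) §2; D. Arapura, Motivation for Hodge cycles, Adv. Math. 207 (2006), Cor. 23, Lemma 4.2, Cor. 7.5; S. Tankeev, Izv. Math.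
75 (2011); F. Charles, E. Markman, Compos. Math. 149 (2013) Thm. 1.1; C. Voisin (2025) §3.2.2 Conj. 3.11.
-/

set_option linter.dupNamespace false

noncomputable section

open CategoryTheory AlgebraicGeometry MonoidalCategory
open Literature.AlgebraicGeometry.Motives Literature.AlgebraicGeometry.HodgeTheory
open Summit.HodgeConjecture.HodgeConjecture.Theorems

namespace Summit.HodgeConjecture.HodgeConjecture.Theorems.LefschetzStandardShadows

universe u

/-! ## §1 OPEN rungs (typed; nothing asserted) -/

/-- **RUNG SCB-∞ (OPEN; Grothendieck's Lefschetz standard conjecture): `B(X)` for every smooth projective complex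
variety**, in the tree's `⋆_L`-form `StandardConjectureBStar` for every degree-2 class `η` (vacuous off polarisation classes).
An open conjecture typed as a `Prop`; nothing is asserted. -/
def LefschetzStandardAll : Prop :=
  ∀ ⦃n : ℕ⦄ ⦃X : SchemeOver ℂ⦄, IsSmoothProjective n X → ∀ η : complexBetti X 2, StandardConjectureBStar n X η

/-- **RUNG SCB-3 (OPEN): `B(X)` for every smooth projective complex THREEFOLD.** Known locus in print: Kodaira
dimension `< 3` (Tankeev 2010/2011), `h^{2,0}(X) = 0` (tree theorem
`standardConjectureBStar_threefold_of_forall_isOfHodgeType_one_one`; Hu–Li 2021 via Friedlander–Mazur), special fibred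
general-type families (Tankeev 2019, 2020). An open statement typed as a `Prop`; nothing is asserted. -/
def LefschetzStandardThreefolds : Prop :=
  ∀ ⦃X : SchemeOver ℂ⦄, IsSmoothProjective 3 X → ∀ η : complexBetti X 2, StandardConjectureBStar 3 X η

/-- **RUNG SCB-4 (OPEN): `B(X)` for every smooth projective complex FOURFOLD.** Known locus in print: unirational
fourfolds (Arapura 2006 Cor. 23), `h^{2,0} = 0 = b₃` (tree theorem
`standardConjectureBStar_fourfold_of_forall_isOfHodgeType_one_one`), hyper-Kähler fourfolds of `K3^{[2]}`- or `Kum²`-type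
(Charles–Markman; Foster), Tankeev's elliptic / abelian-fibred fourfolds. An open statement typed as a `Prop`; nothing is
asserted. -/
def LefschetzStandardFourfolds : Prop :=
  ∀ ⦃X : SchemeOver ℂ⦄, IsSmoothProjective 4 X → ∀ η : complexBetti X 2, StandardConjectureBStar 4 X η

/-- **RUNG HC22sq3 (OPEN): rational `(2,2)`-classes on the square `X × X` of every smooth projective threefold are
algebraic** — the one Hodge statement that `B` for threefolds consumes (`lefschetzStandardThreefolds_of_codimTwo`). An open
statement typed as a `Prop`; nothing is asserted. -/
def HodgeCodimTwoSquaresOfThreefolds : Prop :=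
  ∀ ⦃X : SchemeOver ℂ⦄, IsSmoothProjective 3 X →
    ∀ c : complexBetti (X ⊗ X) (2 * 2), IsRationalClass c →
      IsOfHodgeType (3 + 3) (X ⊗ X) (2 * 2) 2 2 c → c ∈ algebraicClasses (X ⊗ X) 2

/-- **RUNG SCB-BL (expected assemblable over the tree, not claimed here): `B⋆` ascends along smooth blow-ups** —
for a blow-up `b : X' ⟶ X` of a smooth projective `n`-fold along a smooth closed centre `Z` of dimension `k < n`
(`IsSmoothBlowupAlong`), `(∀ η, B⋆(X, η)) ∧ (∀ η, B⋆(Z, η)) ⇒ ∀ θ, B⋆(X', θ)`. Route to a proof: `H*(X')` is spanned by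
`b^* H*(X)` and `j_* (q^* H*(Z) ∪ ζⁱ)` (blow-up formula), all given by algebraic correspondences from `X ⊗ Z`, so `X'` is
dominated by powers of `X ⊗ Z`; then `Ring2.AbelianAll.standardConjectureBStar_tensor_of_forall` and
`standardConjectureBStar_of_isDominatedByPowers_of_forall`. A statement typed as a `Prop`; nothing is asserted. -/
def StandardBAscendsSmoothBlowups : Prop :=
  ∀ ⦃n k : ℕ⦄ ⦃X Z X' : SchemeOver ℂ⦄ ⦃i : Z ⟶ X⦄ ⦃b : X' ⟶ X⦄, IsSmoothBlowupAlong n k X Z X' i b → k < n →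
    (∀ η : complexBetti X 2, StandardConjectureBStar n X η) →
      (∀ η : complexBetti Z 2, StandardConjectureBStar k Z η) →
        ∀ θ : complexBetti X' 2, StandardConjectureBStar n X' θ

/-! ## §2 SHADOW certificates: the summit implies every `B`-row (sorry-free over the tree) -/

/-- **`HodgeConjecture ⇒ B(X)` for all `X`**: the summit statement gives `HC(X × X)` (`IsSmoothProjective.tensor_holds`),
and `HC(X × X) ⇒ B⋆(X, η)` is the tree theorem `standardConjectureBStar_of_hodgeConjectureFor_prod` (Kleiman 1968 §2 /
Voisin 2025 Conj. 3.11 in the tree's form). A SHADOW certificate: it credits nothing toward the summit.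
[cite: Kleiman1968AlgebraicCycles, §2] [cite: Voisin2025, §3.2.2 Conj. 3.11] -/
theorem lefschetzStandardAll_of_hodgeConjecture (h : _root_.HodgeConjecture) : LefschetzStandardAll :=
  fun _ _ hX η ↦ standardConjectureBStar_of_hodgeConjectureFor_prod hX (h (hX.tensor_holds hX)) η

/-- **`HodgeConjecture ⇒ HC22sq3`** (the instance `p = 2` of the summit statement on the sixfold `X × X`). SHADOW
certificate. [cite: Kleiman1968AlgebraicCycles, §2] -/
theorem hodgeCodimTwoSquaresOfThreefolds_of_hodgeConjecture (h : _root_.HodgeConjecture) :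
    HodgeCodimTwoSquaresOfThreefolds :=
  fun _ hX c hc hH ↦ (h (hX.tensor_holds hX)).2 2 c hc hH

/-- **`HC22sq3 ⇒ B` for all threefolds**: by the tree theorem `standardConjectureBStar_threefold_of_codimTwo` the single
non-free degree of `⋆_L` on a threefold is `H⁴ → H²`, whose correspondence is a rational `(2,2)`-class on `X × X`.
[cite: Kleiman1968AlgebraicCycles, §2] [cite: Arapura2006, Cor. 23] -/
theorem lefschetzStandardThreefolds_of_codimTwo (h : HodgeCodimTwoSquaresOfThreefolds) :
    LefschetzStandardThreefolds :=
  fun _ hX η ↦ standardConjectureBStar_threefold_of_codimTwo hX (h hX) η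

/-- SCB-∞ specialises to SCB-3. [cite: Grothendieck1968, §3] -/
theorem lefschetzStandardThreefolds_of_all (h : LefschetzStandardAll) : LefschetzStandardThreefolds :=
  fun _ hX η ↦ h hX η

/-- SCB-∞ specialises to SCB-4. [cite: Grothendieck1968, §3] -/
theorem lefschetzStandardFourfolds_of_all (h : LefschetzStandardAll) : LefschetzStandardFourfolds :=
  fun _ hX η ↦ h hX η

/-! ## §3 Corollaries of the rung SCB-BL (fact-free given SCB-BL) -/

variable {n : ℕ} {X Z : SchemeOver ℂ}

/-- **`B⋆` is stable under blowing up a smooth centre of dimension `≤ 2`** (points, curves, surfaces) in ANY dimension,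
granted SCB-BL: the centre's `B⋆` is the tree theorem `forall_standardConjectureBStar_of_dim_le_two` (Lefschetz `(1,1)` +
hard Lefschetz in dimension `≤ 2`). [cite: Arapura2006, Lemma 4.2] [cite: Murre1977, Lemma 2 (p. 231)] -/
theorem scb_of_smoothBlowup_centre_le_two (hBL : StandardBAscendsSmoothBlowups) {k : ℕ} {X' : SchemeOver ℂ}
    {i : Z ⟶ X} {b : X' ⟶ X} (h : IsSmoothBlowupAlong n k X Z X' i b) (hk2 : k ≤ 2) (hkn : k < n)
    (hB : ∀ η : complexBetti X 2, StandardConjectureBStar n X η) (θ : complexBetti X' 2) :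
    StandardConjectureBStar n X' θ :=
  hBL h hkn hB (fun η ↦ forall_standardConjectureBStar_of_dim_le_two hk2 h.2.1 η) θ

/-- **In particular for THREEFOLDS every smooth blow-up preserves `B⋆`** (centres have dimension `≤ 2`), granted SCB-BL.
[cite: Arapura2006, Lemma 4.2] [cite: Murre1977, Lemma 2 (p. 231)] -/
theorem scb_of_smoothBlowup_threefold (hBL : StandardBAscendsSmoothBlowups) {k : ℕ} {X' : SchemeOver ℂ}
    {i : Z ⟶ X} {b : X' ⟶ X} (h : IsSmoothBlowupAlong 3 k X Z X' i b) (hkn : k < 3)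
    (hB : ∀ η : complexBetti X 2, StandardConjectureBStar 3 X η) (θ : complexBetti X' 2) :
    StandardConjectureBStar 3 X' θ :=
  scb_of_smoothBlowup_centre_le_two hBL h (by omega) hkn hB θ

/-- **… and along towers**: granted SCB-BL, `B⋆` holds for the top of any finite tower of smooth blow-ups of a threefold
with `B⋆` (the shape in which uniruled threefolds — Arapura 2006 Cor. 23 — and birational models enter: resolve
`S × ℙ¹ ⇢ X` by such a tower, then descend along the surjection by `standardConjectureBStar_of_surjective_of_forall`).
[cite: Arapura2006, Cor. 23 and Lemma 4.2] -/
theorem scb_of_smoothBlowupTower_threefold (hBL : StandardBAscendsSmoothBlowups)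
    {T : ℕ → SchemeOver ℂ} (hT0 : IsSmoothProjective 3 (T 0))
    (hB0 : ∀ η : complexBetti (T 0) 2, StandardConjectureBStar 3 (T 0) η)
    (step : ∀ j : ℕ, ∃ (k : ℕ) (Z : SchemeOver ℂ) (i : Z ⟶ T j) (b : T (j + 1) ⟶ T j),
      IsSmoothBlowupAlong 3 k (T j) Z (T (j + 1)) i b ∧ k < 3) (j : ℕ) :
    IsSmoothProjective 3 (T j) ∧ ∀ θ : complexBetti (T j) 2, StandardConjectureBStar 3 (T j) θ := by
  induction j with
  | zero => exact ⟨hT0, hB0⟩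
  | succ j ih =>
    obtain ⟨k, Z, i, b, h, hk⟩ := step j
    exact ⟨h.2.2.1, scb_of_smoothBlowup_threefold hBL h hk ih.2⟩

end Summit.HodgeConjecture.HodgeConjecture.Theorems.LefschetzStandardShadows

end
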